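import Summits.SmoothPoincare4.SmoothPoincare4.Theorems.SullivanDualTargetHelperIntegralForm
import Summits.SmoothPoincare4.SmoothPoincare4.Theorems.SullivanDualTargetHelperCroftonIntegrand
import Summits.SmoothPoincare4.SmoothPoincare4.Theorems.SullivanDualTargetHelperCroftonPositivity
import Summits.SmoothPoincare4.SmoothPoincare4.Theorems.SullivanDualTargetHelperAreaFormFamily

/-!
# Stub `stub_croftonTaming` of line `crofton-pencil-laminar-charge` — the relative CROFTON TAMING
form as a parametric integral (crux `SullivanDual.Target`, stmt-SmoothPoincare4-7823, skeleton v2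
`Cruxes/Target/Lines/crofton_pencil_laminar_charge.lean`)

Registered stub (skeleton v2, Stub 1). Given ANY field of endomorphisms `J` of `T(Σ ∖ p)` and two
direction-parametrised INTERCEPT FAMILIES `Φ σ : ℂ → (Σ ∖ p) → ℂ` (`σ : Bool`, the two affine
charts of the dual plane) with
(Q1) `(a, x) ↦ Φ σ a x` jointly `C^∞`;
(Q2) positively oriented `J`-complex transverse differential: `L v ≠ 0 ⇒ dA(L v, L (J v)) > 0`,
     `L = d_x(Φ σ a)`, `dA(α, β) = Re α Im β − Im α Re β`;
(Q3) transverse pencils: a non-zero vector is killed by `d_x(Φ σ a)` for at most one `a`;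
(Q4) a charged member through every point (`‖a‖ ≤ 1`, `‖Φ σ a x‖ ≤ R₀` in one of the charts),
there is a smooth CLOSED `2`-form `sf` on `Σ ∖ p` with `sf(v, Jv) > 0` for all `v ≠ 0`
(Gromov 1985 §2.4.A′, "taming is necessary for many closed `J`-curves in dimension 4", made
relative and read through intercept maps).

Proof = assembly of the four landed helpers of this line:
* the weight `ρ(a, b) = ρ₁(a) ρ₂(b)`, a product of Mathlib bump functions on `ℂ` (`ρ ≥ 0`,
  `ρ > 0` on `{‖a‖ < 2, ‖b‖ < R₁ + 1}`, `R₁ = max R₀ 0`, `ρ = 0` for `‖a‖ ≥ 3`);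
* `helper_areaFormFamily` (p127984): the smooth `2`-form `β = ρ · pr₂^* dA` on `ℂ × ℂ`, its
  evaluation formula, and `dβ = 0` on triples tangent to `{0} × ℂ`;
* `helper_croftonIntegrand` (p128087): the pulled-back family
  `γ σ a = (x ↦ (a, Φ σ a x))^* β` vanishes for `‖a‖ ≥ 3`, has jointly `C^∞` chart
  representatives, is closed, and `γ σ a x (v, w) = β_{(a, Φ σ a x)}((0, L v), (0, L w))`;
* `helper_integralForm` (p128272): the Bochner integral `sf σ x = ∫ γ σ a x da` is a smooth closed
  form and evaluation commutes with the integral;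
* `helper_croftonPositivity` (p128278): `Σ_σ ∫ ρ(a, Φ σ a x) dA(L v, L Jv) da > 0` for `v ≠ 0`.
`sf := sf false + sf true`.

References: M. Gromov, Invent. Math. 82 (1985) §2.4.A′; B. McKay, math/0101017 §6 (dual planes);
C. H. Taubes, arXiv:0910.5440 (closed forms by moduli-space integration).
-/

noncomputable section

-- the prescribed namespace `Summit.<P>.<Sub>.…` duplicates `SmoothPoincare4` (P = Sub)
set_option linter.dupNamespace false

open scoped Manifold ContDiff Topology
open Set Filter MeasureTheory Literature.Geometry.Kaehler Literature.Geometry.Symplectic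
  Literature.Topology.FourManifolds

namespace Summit.SmoothPoincare4.SmoothPoincare4.Theorems.Target.CroftonPencil

-- The identification `TangentSpace I x = E` is an abuse of definitional equality; as in Mathlib's
-- tangent-bundle files we let `isDefEq` unfold it.
set_option backward.isDefEq.respectTransparency false

/-- **The Crofton weight.** For every `R₁ ≥ 0` there is a `C^∞` function `ρ ≥ 0` on `ℂ × ℂ`,
positive on `{‖a‖ < 2, ‖b‖ < R₁ + 1}` and vanishing for `‖a‖ ≥ 3` (a product of two bump
functions). [folklore] -/
theorem exists_croftonWeight (R₁ : ℝ) (hR₁ : 0 ≤ R₁) :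
    ∃ ρ : ℂ × ℂ → ℝ, ContDiff ℝ ∞ ρ ∧ (∀ q, 0 ≤ ρ q) ∧
      (∀ q : ℂ × ℂ, ‖q.1‖ < 2 → ‖q.2‖ < R₁ + 1 → 0 < ρ q) ∧
      (∀ q : ℂ × ℂ, 3 ≤ ‖q.1‖ → ρ q = 0) := by
  let ρ₁ : ContDiffBump (0 : ℂ) := ⟨2, 3, by norm_num, by norm_num⟩
  let ρ₂ : ContDiffBump (0 : ℂ) := ⟨R₁ + 1, R₁ + 2, by linarith, by linarith⟩
  refine ⟨fun q => ρ₁ q.1 * ρ₂ q.2, ?_, fun q => mul_nonneg ρ₁.nonneg ρ₂.nonneg, ?_, ?_⟩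
  · exact (ρ₁.contDiff.comp contDiff_fst).mul (ρ₂.contDiff.comp contDiff_snd)
  · intro q h1 h2
    refine mul_pos (ρ₁.pos_of_mem_ball ?_) (ρ₂.pos_of_mem_ball ?_)
    · rw [Metric.mem_ball, dist_zero_right]
      show ‖q.1‖ < 3
      linarith
    · rw [Metric.mem_ball, dist_zero_right]
      show ‖q.2‖ < R₁ + 2
      linarith
  · intro q hq
    have h : ρ₁ q.1 = 0 := by
      apply ρ₁.zero_of_le_dist
      rw [dist_zero_right]
      exact hq
    simp [h]

/-- **Registered stub `stub_croftonTaming`** (skeleton v2 of line `crofton-pencil-laminar-charge`,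
crux stmt-SmoothPoincare4-7823; signature registered verbatim): from intercept families with
(Q1)–(Q4) a smooth closed `2`-form taming `J`.  Assembly of `helper_areaFormFamily`,
`helper_croftonIntegrand`, `helper_integralForm`, `helper_croftonPositivity` with the weight of
`exists_croftonWeight`; see the module docstring. [cite: Gromov1985, §2.4.A′] -/
theorem stub_croftonTaming :
    ∀ (S : HomotopySphere 4) (p : S.carrier)
      (J : ∀ x : punctured p, TangentSpace (𝓡 4) x →L[ℝ] TangentSpace (𝓡 4) x)
      (Φ : Bool → ℂ → punctured p → ℂ) (R₀ : ℝ),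
      (∀ σ, ContMDiff (𝓘(ℝ, ℂ).prod (𝓡 4)) 𝓘(ℝ, ℂ) ∞ (Function.uncurry (Φ σ))) →
      (∀ σ (a : ℂ) (x : punctured p) (v : TangentSpace (𝓡 4) x),
        mfderiv (𝓡 4) 𝓘(ℝ, ℂ) (Φ σ a) x v ≠ 0 →
        0 < (mfderiv (𝓡 4) 𝓘(ℝ, ℂ) (Φ σ a) x v).re * (mfderiv (𝓡 4) 𝓘(ℝ, ℂ) (Φ σ a) x (J x v)).im
            - (mfderiv (𝓡 4) 𝓘(ℝ, ℂ) (Φ σ a) x v).im * (mfderiv (𝓡 4) 𝓘(ℝ, ℂ) (Φ σ a) x (J x v)).re) →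
      (∀ σ (x : punctured p) (v : TangentSpace (𝓡 4) x) (a a' : ℂ), v ≠ 0 →
        mfderiv (𝓡 4) 𝓘(ℝ, ℂ) (Φ σ a) x v = 0 → mfderiv (𝓡 4) 𝓘(ℝ, ℂ) (Φ σ a') x v = 0 → a = a') →
      (∀ x : punctured p, ∃ (σ : Bool) (a : ℂ), ‖a‖ ≤ 1 ∧ ‖Φ σ a x‖ ≤ R₀) →
      ∃ sf : MForm (𝓡 4) (punctured p) ℝ 2, IsSmoothForm sf ∧ IsClosedForm sf ∧
        ∀ (x : punctured p) (v : TangentSpace (𝓡 4) x), v ≠ 0 → 0 < sf x ![v, J x v] := by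
  intro S p J Φ R₀ hQ1 hQ2 hQ3 hQ4
  -- enlarge the intercept bound to a non-negative one
  set R₁ : ℝ := max R₀ 0 with hR₁
  have hR₁0 : 0 ≤ R₁ := le_max_right _ _
  have hQ4' : ∀ x : punctured p, ∃ (σ : Bool) (a : ℂ), ‖a‖ ≤ 1 ∧ ‖Φ σ a x‖ ≤ R₁ := by
    intro x
    obtain ⟨σ, a, ha, hb⟩ := hQ4 x
    exact ⟨σ, a, ha, hb.trans (le_max_left _ _)⟩
  -- the weight and the area form on `ℂ × ℂ`
  obtain ⟨ρ, hρs, hρ0, hρpos, hρ3⟩ := exists_croftonWeight R₁ hR₁0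
  obtain ⟨β, hβs, hβeval, hβd⟩ := helper_areaFormFamily ρ hρs
  have hβ0 : ∀ q : ℂ × ℂ, 3 ≤ ‖q.1‖ → β q = 0 := by
    intro q hq
    ext m
    have hm : m = ![m 0, m 1] := by
      funext i
      fin_cases i <;> rfl
    rw [hm, hβeval, hρ3 q hq, zero_mul]
    simp
  -- the pulled-back families and their integrals, one per chart
  have key : ∀ σ : Bool, ∃ sfσ : MForm (𝓡 4) (punctured p) ℝ 2,
      IsSmoothForm sfσ ∧ IsClosedForm sfσ ∧
      ∀ (x : punctured p) (v w : TangentSpace (𝓡 4) x),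
        sfσ x ![v, w] = ∫ a, ρ (a, Φ σ a x) *
          ((mfderiv (𝓡 4) 𝓘(ℝ, ℂ) (Φ σ a) x v).re * (mfderiv (𝓡 4) 𝓘(ℝ, ℂ) (Φ σ a) x w).im
            - (mfderiv (𝓡 4) 𝓘(ℝ, ℂ) (Φ σ a) x v).im * (mfderiv (𝓡 4) 𝓘(ℝ, ℂ) (Φ σ a) x w).re) := by
    intro σ
    obtain ⟨hsupp, hjoint, hclosed, heval⟩ :=
      helper_croftonIntegrand S p (Φ σ) β 3 (hQ1 σ) hβs hβ0 hβd
    set γ : ℂ → MForm (𝓡 4) (punctured p) ℝ 2 :=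
      fun a => β.pullback (𝓡 4) (fun x : punctured p => (a, Φ σ a x)) with hγ
    let sfσ : MForm (𝓡 4) (punctured p) ℝ 2 := fun x =>
      ((∫ a, (γ a x : EuclideanSpace ℝ (Fin 4) [⋀^Fin 2]→L[ℝ] ℝ)) :
        EuclideanSpace ℝ (Fin 4) [⋀^Fin 2]→L[ℝ] ℝ)
    obtain ⟨hsm, hcl, hev⟩ :=
      helper_integralForm S p γ 3 hsupp hjoint hclosed sfσ (fun x => rfl)
    refine ⟨sfσ, hsm, hcl, fun x v w => ?_⟩
    rw [hev x ![v, w]]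
    refine integral_congr_ae (Eventually.of_forall fun a => ?_)
    show γ a x ![v, w] = _
    rw [hγ]
    dsimp only
    rw [heval a x v w, hβeval]
  choose sfB hsmB hclB hevB using key
  refine ⟨sfB false + sfB true, (hsmB false).add (hsmB true), ?_, ?_⟩
  · -- closedness of the sum
    show mextDeriv (sfB false + sfB true) = 0
    rw [mextDeriv_add (hsmB false) (hsmB true)]
    have h1 : mextDeriv (sfB false) = 0 := hclB false
    have h2 : mextDeriv (sfB true) = 0 := hclB true
    rw [h1, h2, add_zero]
  · -- positivity on `(v, Jv)`
    intro x v hv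
    have hadd : (sfB false + sfB true) x ![v, J x v] =
        sfB false x ![v, J x v] + sfB true x ![v, J x v] := rfl
    rw [hadd, hevB false x v (J x v), hevB true x v (J x v)]
    exact helper_croftonPositivity S p J Φ R₁ ρ hQ1 hQ2 hQ3 hQ4' hρs.continuous hρ0 hρpos hρ3
      x v hv

end Summit.SmoothPoincare4.SmoothPoincare4.Theorems.Target.CroftonPencil

end
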